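import Literature.NumberTheory.Sieve.CFSemigroupRenewalEven
import HarnessLib

/-!
# The Frobenius norm of a word matrix and the boundary denominators (bridging lemma)

Support file (all results proved) for the named fact
`Literature.NumberTheory.Sieve.MageeOhWinter2019_uniformCounting` (`CFSemigroupCounting.lean`).
[MageeOhWinter2019, Lemma 12] ("bridging"): the hyperbolic displacement `d(o, γ γ₀ o) - d(o, γ₀ o)`
agrees with the boundary distortion `τⁿ(γ γ₀ k₀)` (disc model) up to `O(κ^N)`, `N = |γ₀|`. For the
Frobenius norm `‖γ‖²_F = 2 cosh d(i, γ i)` on `SL₂` this is the following explicit comparison,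
which we prove by pure algebra: for word matrices `M_u`, `M_v` (`|v| = N ≥ 1`),
`‖M_u M_v‖²_F = |d_u(w_v)|² C_v (1 + |M_u · w_v|²)` with `w_v = M_v · i ∈ ℂ`, `C_v = |d_v(i)|²`, and
`w_v` lies within `η_v ≤ 2^{1-N}` of the boundary point `x_v = M_v · 0 ∈ [0,1]`, whence
`e^{-16 η_v} ≤ ‖M_u M_v‖²_F / (d_u(x_v)² (1 + (M_u x_v)²) C_v) ≤ e^{9 η_v}`:

* `cfDenC`, `cfMoebC`: the complex denominator and Möbius action, cocycle and composition rules,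
  `cfMoebC_sub` (`M z - M w = det M (z - w)/(d(z) d(w))`);
* `normSq_entries_eq`: `Σ Mᵢⱼ² = |d_M(i)|² (1 + |M · i|²)`;
* `cfEta`, `cfEta_le`: `η_v = |M_v i - M_v 0| ≤ q_v^{-2} ≤ 2^{1-N}`;
* `normSq_cfMat_append_le`, `le_normSq_cfMat_append`: the two-sided bridging inequalities.
  [cite: MageeOhWinter2019, Lemma 12]

## References

* M. Magee, H. Oh, D. Winter, J. reine angew. Math. 753 (2019) 89–135, Lemma 12. [MageeOhWinter2019]
-/

noncomputable section

open Set Filter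
open scoped Topology

namespace Literature.NumberTheory.Sieve

variable {A : Finset ℕ}

/-! ### The complex denominator and Möbius action -/

/-- The complex denominator `d_M(z) = M₁₀ z + M₁₁`. [folklore] -/
def cfDenC (M : Matrix (Fin 2) (Fin 2) ℤ) (z : ℂ) : ℂ := (M 1 0 : ℂ) * z + M 1 1

/-- The complex Möbius action `M · z = (M₀₀ z + M₀₁)/(M₁₀ z + M₁₁)`. [folklore] -/
def cfMoebC (M : Matrix (Fin 2) (Fin 2) ℤ) (z : ℂ) : ℂ := ((M 0 0 : ℂ) * z + M 0 1) / cfDenC M z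

/-- On real points the complex denominator is the real one. [folklore] -/
theorem cfDenC_ofReal (M : Matrix (Fin 2) (Fin 2) ℤ) (x : ℝ) : cfDenC M x = (cfDenom M x : ℂ) := by
  simp [cfDenC, cfDenom]

/-- On real points the complex action is the real one. [folklore] -/
theorem cfMoebC_ofReal (M : Matrix (Fin 2) (Fin 2) ℤ) (x : ℝ) : cfMoebC M x = (cfMoeb M x : ℂ) := by
  simp [cfMoebC, cfMoeb, cfDenC]

/-- **The cocycle rule** `d_{MN}(z) = d_M(N z) d_N(z)`. [folklore] -/
theorem cfDenC_mul (M N : Matrix (Fin 2) (Fin 2) ℤ) {z : ℂ} (hN : cfDenC N z ≠ 0) :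
    cfDenC (M * N) z = cfDenC M (cfMoebC N z) * cfDenC N z := by
  have e : cfDenC M (cfMoebC N z) * cfDenC N z =
      (M 1 0 : ℂ) * ((N 0 0 : ℂ) * z + N 0 1) + (M 1 1 : ℂ) * cfDenC N z := by
    rw [cfDenC, cfMoebC, add_mul, mul_assoc, div_mul_cancel₀ _ hN]
  rw [e]
  simp only [cfDenC, Matrix.mul_apply, Fin.sum_univ_two]
  push_cast
  ring

/-- **Composition** `(MN) · z = M · (N · z)`. [folklore] -/
theorem cfMoebC_mul (M N : Matrix (Fin 2) (Fin 2) ℤ) {z : ℂ} (hN : cfDenC N z ≠ 0) (hMN : cfDenC (M * N) z ≠ 0) :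
    cfMoebC (M * N) z = cfMoebC M (cfMoebC N z) := by
  have hM : cfDenC M (cfMoebC N z) ≠ 0 := by
    intro h; apply hMN; rw [cfDenC_mul M N hN, h, zero_mul]
  have hnum : ((M * N) 0 0 : ℂ) * z + (M * N) 0 1 = ((M 0 0 : ℂ) * cfMoebC N z + M 0 1) * cfDenC N z := by
    rw [add_mul, mul_assoc, cfMoebC, div_mul_cancel₀ _ hN]
    simp only [cfDenC, Matrix.mul_apply, Fin.sum_univ_two]
    push_cast
    ring
  rw [cfMoebC, cfMoebC, cfDenC_mul M N hN, div_eq_div_iff (mul_ne_zero hM hN) hM, hnum]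
  ring

/-- **The difference formula** `M · z - M · w = det M · (z - w) / (d_M(z) d_M(w))`. [folklore] -/
theorem cfMoebC_sub (M : Matrix (Fin 2) (Fin 2) ℤ) {z w : ℂ} (hz : cfDenC M z ≠ 0) (hw : cfDenC M w ≠ 0) :
    cfMoebC M z - cfMoebC M w = (M.det : ℂ) * (z - w) / (cfDenC M z * cfDenC M w) := by
  rw [cfMoebC, cfMoebC, div_sub_div _ _ hz hw, Matrix.det_fin_two]
  simp only [cfDenC] at hz hw ⊢
  congr 1
  push_cast
  ring

/-- **The Frobenius norm via the action on `i`:** `Σᵢⱼ Mᵢⱼ² = |d_M(i)|² (1 + |M · i|²)` (whenever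
`d_M(i) ≠ 0`). [cite: MageeOhWinter2019, §3] -/
theorem normSq_entries_eq (M : Matrix (Fin 2) (Fin 2) ℤ) (h : cfDenC M Complex.I ≠ 0) :
    (∑ i, ∑ j, ((M i j : ℤ) : ℝ) ^ 2) = ‖cfDenC M Complex.I‖ ^ 2 * (1 + ‖cfMoebC M Complex.I‖ ^ 2) := by
  have hd : ‖cfDenC M Complex.I‖ ^ 2 = (M 1 0 : ℝ) ^ 2 + (M 1 1 : ℝ) ^ 2 := by
    rw [cfDenC, Complex.sq_norm, Complex.normSq_apply]
    simp
    ring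
  have hn : ‖(M 0 0 : ℂ) * Complex.I + M 0 1‖ ^ 2 = (M 0 0 : ℝ) ^ 2 + (M 0 1 : ℝ) ^ 2 := by
    rw [Complex.sq_norm, Complex.normSq_apply]
    simp
    ring
  have hpos : 0 < ‖cfDenC M Complex.I‖ ^ 2 := by positivity
  rw [cfMoebC, norm_div, div_pow, mul_add, mul_one, mul_div_cancel₀ _ hpos.ne', hd, hn]
  simp only [Fin.sum_univ_two]
  ring

/-! ### Word matrices: the suffix data `x_v`, `w_v`, `C_v`, `η_v` -/

section Words

variable (hA : ∀ a ∈ A, 1 ≤ a)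
include hA

/-- Digits of the extension are `≥ 1`. [folklore] -/
theorem one_le_cfExt_coe {N : ℕ} (v : Fin N → A) (i : ℕ) : 1 ≤ cfExt (fun i => ((v i : A) : ℕ)) i :=
  one_le_cfExt (one_le_coe_digit hA v) i

omit hA in
/-- The entries of a word matrix are non-negative. [folklore] -/
theorem cfMat_nonneg {N : ℕ} (v : Fin N → A) (i j : Fin 2) : 0 ≤ cfMat (fun i => ((v i : A) : ℕ)) i j :=
  cfWord_nonneg _ _ i j

/-- `q' ≤ q`: `(M_v)₁₀ ≤ (M_v)₁₁`. [folklore] -/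
theorem cfMat_10_le_11 {N : ℕ} (v : Fin N → A) : cfMat (fun i => ((v i : A) : ℕ)) 1 0 ≤ cfMat (fun i => ((v i : A) : ℕ)) 1 1 :=
  cfWord_10_le_cfDen (one_le_cfExt_coe hA v) N

/-- `1 ≤ q`. [folklore] -/
theorem one_le_cfMat_11 {N : ℕ} (v : Fin N → A) : 1 ≤ cfMat (fun i => ((v i : A) : ℕ)) 1 1 :=
  one_le_cfDen (one_le_cfExt_coe hA v) N

/-- The complex denominator of a word matrix at `i` does not vanish. [folklore] -/
theorem cfDenC_cfMat_I_ne_zero {N : ℕ} (v : Fin N → A) : cfDenC (cfMat fun i => ((v i : A) : ℕ)) Complex.I ≠ 0 := by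
  intro h
  have h1 := congrArg Complex.im h
  simp [cfDenC] at h1
  have := one_le_cfMat_11 hA v
  have h2 := congrArg Complex.re h
  simp [cfDenC] at h2
  omega

omit hA in
/-- The complex denominator at `i` of a word matrix, squared: `C_v = q'² + q² ≥ 1`. [folklore] -/
theorem normSq_cfDenC_cfMat_I {N : ℕ} (v : Fin N → A) :
    ‖cfDenC (cfMat fun i => ((v i : A) : ℕ)) Complex.I‖ ^ 2 =
      ((cfMat (fun i => ((v i : A) : ℕ)) 1 0 : ℤ) : ℝ) ^ 2 + ((cfMat (fun i => ((v i : A) : ℕ)) 1 1 : ℤ) : ℝ) ^ 2 := by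
  rw [cfDenC, Complex.sq_norm, Complex.normSq_apply]
  simp
  ring

/-- `C_v ≥ q_v² ≥ 1`. [folklore] -/
theorem one_le_normSq_cfDenC {N : ℕ} (v : Fin N → A) : 1 ≤ ‖cfDenC (cfMat fun i => ((v i : A) : ℕ)) Complex.I‖ ^ 2 := by
  rw [normSq_cfDenC_cfMat_I v]
  have h1 : (1 : ℝ) ≤ ((cfMat (fun i => ((v i : A) : ℕ)) 1 1 : ℤ) : ℝ) := by exact_mod_cast one_le_cfMat_11 hA v
  nlinarith

/-- **The suffix point `w_v = M_v · i` is within `η_v ≤ q_v^{-2}` of the boundary point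
`x_v = M_v · 0`.** [cite: MageeOhWinter2019, Lemma 12] -/
theorem norm_cfMoebC_I_sub_le {N : ℕ} (v : Fin N → A) :
    ‖cfMoebC (cfMat fun i => ((v i : A) : ℕ)) Complex.I - (cfMoeb (cfMat fun i => ((v i : A) : ℕ)) 0 : ℂ)‖ ≤
      1 / ((cfMat (fun i => ((v i : A) : ℕ)) 1 1 : ℤ) : ℝ) ^ 2 := by
  set M := cfMat fun i => ((v i : A) : ℕ) with hM
  have hq1 : (1 : ℝ) ≤ ((M 1 1 : ℤ) : ℝ) := by exact_mod_cast one_le_cfMat_11 hA v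
  have hI := cfDenC_cfMat_I_ne_zero hA v
  have h0 : cfDenC M ((0 : ℝ) : ℂ) ≠ 0 := by
    rw [cfDenC_ofReal]; norm_cast; simp [cfDenom]; exact_mod_cast (by linarith : (0 : ℝ) < (M 1 1 : ℝ)).ne'
  rw [← cfMoebC_ofReal, show ((0 : ℝ) : ℂ) = 0 from Complex.ofReal_zero] at *
  rw [cfMoebC_sub M hI h0, norm_div, norm_mul, norm_mul, sub_zero, Complex.norm_I, mul_one]
  have hdet : ‖(M.det : ℂ)‖ = 1 := by
    rw [hM, cfMat, det_cfWord]; simp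
  rw [hdet, one_div, one_div]
  have hden0 : ‖cfDenC M 0‖ = ((M 1 1 : ℤ) : ℝ) := by
    simp [cfDenC]
    exact_mod_cast (by linarith : (0 : ℝ) ≤ (M 1 1 : ℝ))
  have hdenI : ((M 1 1 : ℤ) : ℝ) ≤ ‖cfDenC M Complex.I‖ := by
    have h := normSq_cfDenC_cfMat_I v
    rw [← hM] at h
    have hnn : (0 : ℝ) ≤ ‖cfDenC M Complex.I‖ := norm_nonneg _
    nlinarith [sq_nonneg ((M 1 0 : ℤ) : ℝ)]
  rw [hden0]
  refine inv_anti₀ (by positivity) ?_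
  calc ((M 1 1 : ℤ) : ℝ) ^ 2 = ((M 1 1 : ℤ) : ℝ) * ((M 1 1 : ℤ) : ℝ) := sq _
    _ ≤ ‖cfDenC M Complex.I‖ * ((M 1 1 : ℤ) : ℝ) := mul_le_mul_of_nonneg_right hdenI (by linarith)

/-- `η_v ≤ 2^{1-N}` (`q_v² ≥ 2^{N-1}`). [cite: MageeOhWinter2019, Lemma 12] -/
theorem norm_cfMoebC_I_sub_le_geom {N : ℕ} (v : Fin N → A) :
    ‖cfMoebC (cfMat fun i => ((v i : A) : ℕ)) Complex.I - (cfMoeb (cfMat fun i => ((v i : A) : ℕ)) 0 : ℂ)‖ ≤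
      (1 / 2 : ℝ) ^ (N - 1) := by
  refine (norm_cfMoebC_I_sub_le hA v).trans ?_
  have h := pow_le_cfQ_sq (one_le_coe_digit hA v)
  rw [cfQ_eq] at h
  have h' : (2 : ℝ) ^ (N - 1) ≤ ((cfMat (fun i => ((v i : A) : ℕ)) 1 1 : ℤ) : ℝ) ^ 2 := by exact_mod_cast h
  rw [one_div, one_div, inv_pow]
  exact inv_anti₀ (by positivity) h'

end Words

/-! ### The bridging inequalities -/

section Bridging

variable (hA : ∀ a ∈ A, 1 ≤ a)
include hA

omit hA in
/-- `1 + 9η ≤ e^{9η}` and `e^{-16η} ≤ 1 - 8η` for `0 ≤ η ≤ 1/16`. [folklore] -/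
theorem exp_bounds {η : ℝ} (h0 : 0 ≤ η) (h1 : η ≤ 1 / 16) :
    1 + 9 * η ≤ Real.exp (9 * η) ∧ Real.exp (-(16 * η)) ≤ 1 - 8 * η := by
  refine ⟨by linarith [Real.add_one_le_exp (9 * η)], ?_⟩
  -- `e^{-2x} ≤ 1 - x` for `x ∈ [0, 1/2]`: from `e^{-2x} ≤ 1/(1 + 2x) ≤ 1 - x`
  have hx : 0 ≤ 8 * η := by linarith
  have hx1 : 8 * η ≤ 1 / 2 := by linarith
  have h2 : Real.exp (-(16 * η)) ≤ 1 / (1 + 16 * η) := by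
    rw [Real.exp_neg, one_div]
    exact inv_anti₀ (by linarith) (by linarith [Real.add_one_le_exp (16 * η)])
  refine h2.trans ?_
  rw [div_le_iff₀ (by linarith)]
  nlinarith

/-- **Bridging lemma, explicit form** ([MageeOhWinter2019, Lemma 12] for the Frobenius norm): for word
matrices `M_u` (any length) and `M_v` (`|v| = N ≥ 1`) with `η_v = |M_v i - M_v 0| ≤ 1/16`, writing
`x = M_v 0`, `d = d_u(x)`, `y = M_u x`, `C = |d_v(i)|²`:
`e^{-16η} d² (1 + y²) C ≤ ‖M_u M_v‖²_F ≤ e^{9η} d² (1 + y²) C`. [cite: MageeOhWinter2019, Lemma 12] -/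
theorem normSq_mul_bounds {n N : ℕ} (u : Fin n → A) (v : Fin N → A)
    (hη : ‖cfMoebC (cfMat fun i => ((v i : A) : ℕ)) Complex.I - (cfMoeb (cfMat fun i => ((v i : A) : ℕ)) 0 : ℂ)‖ ≤ 1 / 16) :
    let Mu := cfMat fun i => ((u i : A) : ℕ)
    let Mv := cfMat fun i => ((v i : A) : ℕ)
    let x := cfMoeb Mv 0
    let η := ‖cfMoebC Mv Complex.I - (x : ℂ)‖
    let main := cfDenom Mu x ^ 2 * (1 + cfMoeb Mu x ^ 2) * ‖cfDenC Mv Complex.I‖ ^ 2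
    Real.exp (-(16 * η)) * main ≤ (∑ i, ∑ j, (((Mu * Mv) i j : ℤ) : ℝ) ^ 2) ∧
      (∑ i, ∑ j, (((Mu * Mv) i j : ℤ) : ℝ) ^ 2) ≤ Real.exp (9 * η) * main := by
  intro Mu Mv x η main
  have hu1 := one_le_coe_digit hA u
  have hv1 := one_le_coe_digit hA v
  have hx : x ∈ Icc (0 : ℝ) 1 := cfMoeb_cfMat_mem hv1 ⟨le_rfl, zero_le_one⟩
  have hd : 1 ≤ cfDenom Mu x := by
    have h := (cfDenom_cfMat_mem hu1 hx).1
    have h1 : (1 : ℝ) ≤ (cfQ fun i => ((u i : A) : ℕ) : ℝ) := by exact_mod_cast one_le_cfQ hu1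
    exact h1.trans h
  have hdpos : 0 < cfDenom Mu x := by linarith
  have hy : cfMoeb Mu x ∈ Icc (0 : ℝ) 1 := cfMoeb_cfMat_mem hu1 hx
  have hη0 : 0 ≤ η := norm_nonneg _
  have hIv := cfDenC_cfMat_I_ne_zero hA v
  set w : ℂ := cfMoebC Mv Complex.I with hw
  -- the denominators at `w` and at `x`
  have hcu : (0 : ℝ) ≤ (Mu 1 0 : ℝ) := by exact_mod_cast cfMat_nonneg u 1 0
  have hcu_le : ((Mu 1 0 : ℤ) : ℝ) ≤ cfDenom Mu x := by
    have h1 : ((Mu 1 0 : ℤ) : ℝ) ≤ ((Mu 1 1 : ℤ) : ℝ) := by exact_mod_cast cfMat_10_le_11 hA u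
    simp only [cfDenom]
    nlinarith [hx.1]
  have hdiff : cfDenC Mu w - (cfDenom Mu x : ℂ) = (Mu 1 0 : ℂ) * (w - x) := by
    rw [← cfDenC_ofReal]; simp only [cfDenC]; ring
  have hdiff_le : ‖cfDenC Mu w - (cfDenom Mu x : ℂ)‖ ≤ cfDenom Mu x * η := by
    rw [hdiff, norm_mul]
    have : ‖(Mu 1 0 : ℂ)‖ = ((Mu 1 0 : ℤ) : ℝ) := by
      rw [show (Mu 1 0 : ℂ) = (((Mu 1 0 : ℤ) : ℝ) : ℂ) by push_cast; rfl, Complex.norm_real, Real.norm_of_nonneg hcu]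
    rw [this]
    exact mul_le_mul_of_nonneg_right hcu_le hη0
  -- `(1-η) d ≤ |d_u(w)| ≤ (1+η) d`
  have hdw_up : ‖cfDenC Mu w‖ ≤ (1 + η) * cfDenom Mu x := by
    have h := norm_add_le (cfDenC Mu w - (cfDenom Mu x : ℂ)) (cfDenom Mu x : ℂ)
    rw [sub_add_cancel, Complex.norm_real, Real.norm_of_nonneg hdpos.le] at h
    nlinarith
  have hdw_lo : (1 - η) * cfDenom Mu x ≤ ‖cfDenC Mu w‖ := by
    have h := norm_sub_norm_le (cfDenom Mu x : ℂ) (cfDenC Mu w)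
    rw [Complex.norm_real, Real.norm_of_nonneg hdpos.le, norm_sub_rev] at h
    nlinarith
  have hη16 : η ≤ 1 / 16 := hη
  have hdw_pos : 0 < ‖cfDenC Mu w‖ := lt_of_lt_of_le (by nlinarith) hdw_lo
  have hdw_ne : cfDenC Mu w ≠ 0 := fun h => by rw [h, norm_zero] at hdw_pos; exact lt_irrefl _ hdw_pos
  -- the images `M_u w` and `y = M_u x`
  have hx0 : cfDenC Mu (x : ℂ) ≠ 0 := by rw [cfDenC_ofReal]; exact_mod_cast hdpos.ne'
  have hdetu : ‖(Mu.det : ℂ)‖ = 1 := by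
    show ‖((cfMat fun i => ((u i : A) : ℕ)).det : ℂ)‖ = 1
    rw [cfMat, det_cfWord]; simp
  have himg : ‖cfMoebC Mu w - (cfMoeb Mu x : ℂ)‖ ≤ 2 * η := by
    rw [← cfMoebC_ofReal, cfMoebC_sub Mu hdw_ne hx0, norm_div, norm_mul, hdetu, one_mul, norm_mul, cfDenC_ofReal,
      Complex.norm_real, Real.norm_of_nonneg hdpos.le]
    rw [div_le_iff₀ (mul_pos hdw_pos hdpos)]
    have h15 : (15 / 16 : ℝ) ≤ ‖cfDenC Mu w‖ := by nlinarith
    show η ≤ 2 * η * (‖cfDenC Mu w‖ * cfDenom Mu x)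
    nlinarith [mul_le_mul h15 hd zero_le_one (norm_nonneg _)]
  have hMw_le : ‖cfMoebC Mu w‖ ≤ 2 := by
    have h := norm_add_le (cfMoebC Mu w - (cfMoeb Mu x : ℂ)) (cfMoeb Mu x : ℂ)
    rw [sub_add_cancel, Complex.norm_real, Real.norm_of_nonneg hy.1] at h
    linarith [hy.2]
  have hsq : |‖cfMoebC Mu w‖ ^ 2 - cfMoeb Mu x ^ 2| ≤ 6 * η := by
    have h1 : |‖cfMoebC Mu w‖ - cfMoeb Mu x| ≤ 2 * η := by
      have h := abs_norm_sub_norm_le (cfMoebC Mu w) (cfMoeb Mu x : ℂ)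
      rw [Complex.norm_real, Real.norm_of_nonneg hy.1] at h
      exact h.trans himg
    rw [sq_sub_sq, abs_mul]
    calc |‖cfMoebC Mu w‖ + cfMoeb Mu x| * |‖cfMoebC Mu w‖ - cfMoeb Mu x| ≤ 3 * (2 * η) := by
          refine mul_le_mul ?_ h1 (abs_nonneg _) (by norm_num)
          rw [abs_of_nonneg (add_nonneg (norm_nonneg _) hy.1)]; linarith [hy.2]
      _ = 6 * η := by ring
  -- the exact identity
  have hMvI : cfDenC Mv Complex.I ≠ 0 := hIv
  have hMuMvI : cfDenC (Mu * Mv) Complex.I ≠ 0 := by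
    rw [cfDenC_mul Mu Mv hMvI]; exact mul_ne_zero hdw_ne hMvI
  have hexact : (∑ i, ∑ j, (((Mu * Mv) i j : ℤ) : ℝ) ^ 2) =
      ‖cfDenC Mu w‖ ^ 2 * ‖cfDenC Mv Complex.I‖ ^ 2 * (1 + ‖cfMoebC Mu w‖ ^ 2) := by
    rw [normSq_entries_eq _ hMuMvI, cfDenC_mul Mu Mv hMvI, norm_mul, mul_pow, cfMoebC_mul Mu Mv hMvI hMuMvI]
  rw [hexact]
  have hC := one_le_normSq_cfDenC hA v
  have hC0 : 0 ≤ ‖cfDenC Mv Complex.I‖ ^ 2 := by positivity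
  obtain ⟨he1, he2⟩ := exp_bounds hη0 hη16
  have hy2 : 0 ≤ cfMoeb Mu x ^ 2 := sq_nonneg _
  have hsq' := abs_le.1 hsq
  constructor
  · -- lower bound
    have hlo1 : (1 - η) ^ 2 * cfDenom Mu x ^ 2 ≤ ‖cfDenC Mu w‖ ^ 2 := by
      rw [← mul_pow]; exact pow_le_pow_left₀ (by nlinarith) hdw_lo 2
    have hlo2 : (1 - 6 * η) * (1 + cfMoeb Mu x ^ 2) ≤ 1 + ‖cfMoebC Mu w‖ ^ 2 := by nlinarith
    have hfac : Real.exp (-(16 * η)) ≤ (1 - η) ^ 2 * (1 - 6 * η) := by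
      have e : (1 - η) ^ 2 * (1 - 6 * η) - (1 - 8 * η) = η ^ 2 * (13 - 6 * η) := by ring
      have hnn : 0 ≤ η ^ 2 * (13 - 6 * η) := mul_nonneg (sq_nonneg η) (by linarith)
      linarith
    calc Real.exp (-(16 * η)) * main
        ≤ (1 - η) ^ 2 * (1 - 6 * η) * main := mul_le_mul_of_nonneg_right hfac (by positivity)
      _ = ((1 - η) ^ 2 * cfDenom Mu x ^ 2) * ‖cfDenC Mv Complex.I‖ ^ 2 * ((1 - 6 * η) * (1 + cfMoeb Mu x ^ 2)) := by
          simp only [main]; ring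
      _ ≤ ‖cfDenC Mu w‖ ^ 2 * ‖cfDenC Mv Complex.I‖ ^ 2 * (1 + ‖cfMoebC Mu w‖ ^ 2) := by
          refine mul_le_mul (mul_le_mul_of_nonneg_right hlo1 hC0) hlo2 (by nlinarith) (by positivity)
  · -- upper bound
    have hup1 : ‖cfDenC Mu w‖ ^ 2 ≤ (1 + η) ^ 2 * cfDenom Mu x ^ 2 := by
      rw [← mul_pow]; exact pow_le_pow_left₀ (norm_nonneg _) hdw_up 2
    have hup2 : 1 + ‖cfMoebC Mu w‖ ^ 2 ≤ (1 + 6 * η) * (1 + cfMoeb Mu x ^ 2) := by nlinarith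
    have hfac : (1 + η) ^ 2 * (1 + 6 * η) ≤ Real.exp (9 * η) := by
      have e : (1 + 9 * η) - (1 + η) ^ 2 * (1 + 6 * η) = η * (1 - 13 * η - 6 * η ^ 2) := by ring
      have hnn : 0 ≤ η * (1 - 13 * η - 6 * η ^ 2) := mul_nonneg hη0 (by nlinarith)
      linarith
    calc ‖cfDenC Mu w‖ ^ 2 * ‖cfDenC Mv Complex.I‖ ^ 2 * (1 + ‖cfMoebC Mu w‖ ^ 2)
        ≤ ((1 + η) ^ 2 * cfDenom Mu x ^ 2) * ‖cfDenC Mv Complex.I‖ ^ 2 * ((1 + 6 * η) * (1 + cfMoeb Mu x ^ 2)) :=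
          mul_le_mul (mul_le_mul_of_nonneg_right hup1 hC0) hup2 (by positivity) (by positivity)
      _ = (1 + η) ^ 2 * (1 + 6 * η) * main := by simp only [main]; ring
      _ ≤ Real.exp (9 * η) * main := mul_le_mul_of_nonneg_right hfac (by positivity)

end Bridging

end Literature.NumberTheory.Sieve
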